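import Mathlib
import Summits.ResolutionOfSingularities.ResolutionOfSingularities.Theorems.WildQuotientsWildQuotientResolutionJordanFiveCentre
import Summits.ResolutionOfSingularities.ResolutionOfSingularities.Theorems.WildQuotientsWildQuotientResolutionLinearSmallBlocksAlgebra

/-!
# N4a (`𝔸ⁿ/(J₃ ⊕ J₂)`, `p ≥ 3`): iterates of `σ`, `σ^p = 1`, and the augmentation ideal `(x_a, x_b, x_d)`

(crux stmt-ResolutionOfSingularities-15640 `WildQuotients.WildQuotientResolution`, line `Sketch`;
post-V5 width target N4a `JordanThreeTwo.jordanThreeTwo_hasResolution` (res-L1-w45c-idea-2 card N,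
res-L1-w45c-plan-1 R-LANE RULING 2026-08-27T14:12:52Z (2); res-L1-w45c-stub-2 SIG 14:24:14Z);
the `J₃ ⊕ J₂` twin of `…JordanFiveOrder` / `…JordanFiveCentre` (inputs of the K1/K2 divisorial
bricks). [OURS · L1 W4.5c] — NOT a statement of any manuscript; replaces the role of no printed item.
Def-free. Prover res-L1-w45c-stub-3.)

`σ = J₃ ⊕ J₂` on `k[x]`: `x_b ↦ x_b + x_a`, `x_c ↦ x_c + x_b`, `x_e ↦ x_e + x_d`, every other variable
(in particular `x_a`, `x_d`) fixed.

* `pow_apply_X_bce`, `pow_apply_X_of_ne` — `σᵐ x_b = x_b + m x_a`,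
  `σᵐ x_c = x_c + m x_b + C(m,2) x_a`, `σᵐ x_e = x_e + m x_d`;
* `pow_prime_eq_one` — `σ^p = 1` (`p ≥ 3 = char k`);
* `apply_X_sub_X_mem_centre`, `smul_sub_mem_centre` — `g • f − f ∈ (x_a, x_b, x_d)` for `g ∈ ⟨σ⟩`;
* **`span_smul_sub_eq_centre_prime`** — for `1 ≠ g ∈ ⟨σ⟩`: `⟨g • f − f⟩ = (x_a, x_b, x_d)`
  (`J₅`'s `exists_natCast_ne_zero_and_pow_eq` and `LinearSmallBlocks.X_mem_augIdeal_of_transvection`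
  on both blocks).
-/

-- single-problem summit: the doubled namespace component `ResolutionOfSingularities` is forced
set_option linter.dupNamespace false

noncomputable section

open MvPolynomial

namespace Summit.ResolutionOfSingularities.ResolutionOfSingularities.Theorems.WildQuotientResolution.JordanThreeTwo

variable (k : Type) [Field k] (n : ℕ) (σ : MvPolynomial (Fin n) k ≃ₐ[k] MvPolynomial (Fin n) k)
  (a b c d e : Fin n) (hab : a ≠ b) (hac : a ≠ c) (hae : a ≠ e) (hbd : b ≠ d) (hcd : c ≠ d)
  (hde : d ≠ e)
  (hb : σ (X b) = X b + X a) (hc : σ (X c) = X c + X b) (he : σ (X e) = X e + X d)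
  (hσ : ∀ i, i ≠ b → i ≠ c → i ≠ e → σ (X i) = X i)

include hσ hab hac hae in
/-- `σ x_a = x_a`. [folklore] -/
theorem apply_X_a : σ (X a) = X a := hσ a hab hac hae

include hσ hbd hcd hde in
/-- `σ x_d = x_d`. [folklore] -/
theorem apply_X_d : σ (X d) = X d := hσ d (Ne.symm hbd) (Ne.symm hcd) hde

include hσ in
/-- `σᵐ x_i = x_i` for `i ∉ {b, c, e}`. [folklore] -/
theorem pow_apply_X_of_ne (m : ℕ) (i : Fin n) (hib : i ≠ b) (hic : i ≠ c) (hie : i ≠ e) :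
    (σ ^ m) (X i) = X i := by
  induction m with
  | zero => simp
  | succ m ih => rw [pow_succ', AlgEquiv.mul_apply, ih, hσ i hib hic hie]

include hab hac hae hbd hcd hde hb hc he hσ in
/-- **Iterates of `J₃ ⊕ J₂` on the moving variables**: `σᵐ x_b = x_b + m x_a`,
`σᵐ x_c = x_c + m x_b + C(m,2) x_a`, `σᵐ x_e = x_e + m x_d` (one statement for the three laws; the
`J₃`-block halves coincide with `JordanThree.pow_apply_X_b/_c`, whose passenger hypothesis
`∀ i ∉ {b,c}, σ xᵢ = xᵢ` FAILS here because `x_e` moves). [folklore] -/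
theorem pow_apply_X_bce (m : ℕ) :
    (σ ^ m) (X b) = X b + (m : MvPolynomial (Fin n) k) * X a ∧
    (σ ^ m) (X c) = X c + (m : MvPolynomial (Fin n) k) * X b +
      ((m.choose 2 : ℕ) : MvPolynomial (Fin n) k) * X a ∧
    (σ ^ m) (X e) = X e + (m : MvPolynomial (Fin n) k) * X d := by
  have ha : σ (X a) = X a := hσ a hab hac hae
  have hd : σ (X d) = X d := hσ d (Ne.symm hbd) (Ne.symm hcd) hde
  have hB : ∀ m : ℕ, (σ ^ m) (X b) = X b + (m : MvPolynomial (Fin n) k) * X a := by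
    intro m
    induction m with
    | zero => simp
    | succ m ih =>
      rw [pow_succ', AlgEquiv.mul_apply, ih, map_add, map_mul, map_natCast, hb, ha]
      push_cast
      ring
  refine ⟨hB m, ?_, ?_⟩
  · induction m with
    | zero => simp
    | succ m ih =>
      rw [pow_succ', AlgEquiv.mul_apply, ih, map_add, map_add, map_mul, map_mul, map_natCast,
        map_natCast, hc, hb, ha, Nat.choose_succ_succ', Nat.choose_one_right]
      push_cast
      ring
  · induction m with
    | zero => simp
    | succ m ih =>
      rw [pow_succ', AlgEquiv.mul_apply, ih, map_add, map_mul, map_natCast, he, hd]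
      push_cast
      ring

include hab hac hae hbd hcd hde hb hc he hσ in
/-- **`σ ^ p = 1`** for `J₃ ⊕ J₂` in characteristic `p ≥ 3` (`p ∣ C(p,2)`). [folklore] -/
theorem pow_prime_eq_one (p : ℕ) (hp : p.Prime) (hp3 : 3 ≤ p) [CharP k p] : σ ^ p = 1 := by
  classical
  have hp0 : ((p : ℕ) : MvPolynomial (Fin n) k) = 0 := CharP.cast_eq_zero _ p
  have hp2 : (((p : ℕ).choose 2 : ℕ) : MvPolynomial (Fin n) k) = 0 :=
    (CharP.cast_eq_zero_iff (MvPolynomial (Fin n) k) p _).2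
      (hp.dvd_choose_self two_ne_zero (by omega))
  have key : ((σ ^ p : MvPolynomial (Fin n) k ≃ₐ[k] MvPolynomial (Fin n) k) :
      MvPolynomial (Fin n) k →ₐ[k] MvPolynomial (Fin n) k) = AlgHom.id k _ := by
    refine MvPolynomial.algHom_ext fun i => ?_
    change (σ ^ p) (X i) = X i
    obtain ⟨hB, hC, hE⟩ := pow_apply_X_bce k n σ a b c d e hab hac hae hbd hcd hde hb hc he hσ p
    by_cases hib : i = b
    · subst hib
      rw [hB, hp0, zero_mul, add_zero]
    by_cases hic : i = c
    · subst hic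
      rw [hC, hp0, hp2, zero_mul, zero_mul, add_zero, add_zero]
    by_cases hie : i = e
    · subst hie
      rw [hE, hp0, zero_mul, add_zero]
    · exact pow_apply_X_of_ne k n σ b c e hσ p i hib hic hie
  apply AlgEquiv.ext
  intro f
  exact DFunLike.congr_fun key f

include hb hc he hσ in
/-- `σ xᵢ - xᵢ ∈ (x_a, x_b, x_d)` for every coordinate (it is `x_a`, `x_b`, `x_d` or `0`).
[folklore] -/
theorem apply_X_sub_X_mem_centre (i : Fin n) :
    σ (X i) - X i ∈ Ideal.span ({X a, X b, X d} : Set (MvPolynomial (Fin n) k)) := by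
  by_cases hib : i = b
  · subst hib
    rw [hb, add_sub_cancel_left]
    exact Ideal.subset_span (Set.mem_insert _ _)
  by_cases hic : i = c
  · subst hic
    rw [hc, add_sub_cancel_left]
    exact Ideal.subset_span (Set.mem_insert_of_mem _ (Set.mem_insert _ _))
  by_cases hie : i = e
  · subst hie
    rw [he, add_sub_cancel_left]
    exact Ideal.subset_span (Set.mem_insert_of_mem _ (Set.mem_insert_of_mem _ rfl))
  · rw [hσ i hib hic hie, sub_self]
    exact Ideal.zero_mem _

include hb hc he hσ in
/-- **`g • r ≡ r` modulo `(x_a, x_b, x_d)`** for every `g ∈ ⟨σ⟩` and every `r ∈ k[x]`. [folklore] -/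
theorem smul_sub_mem_centre (g : Subgroup.zpowers σ) (r : MvPolynomial (Fin n) k) :
    g • r - r ∈ Ideal.span ({X a, X b, X d} : Set (MvPolynomial (Fin n) k)) := by
  classical
  obtain ⟨z, hz⟩ := Subgroup.mem_zpowers_iff.mp g.2
  have hσX : ∀ i : Fin n, σ (X i) - X i ∈
      Ideal.span ({X a, X b, X d} : Set (MvPolynomial (Fin n) k)) :=
    apply_X_sub_X_mem_centre k n σ a b c d e hb hc he hσ
  have hσf : ∀ r : MvPolynomial (Fin n) k, σ r - r ∈
      Ideal.span ({X a, X b, X d} : Set (MvPolynomial (Fin n) k)) := by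
    intro r
    induction r using MvPolynomial.induction_on with
    | C c =>
      have hc' : σ (C c) = C c := σ.commutes c
      rw [hc', sub_self]; exact Ideal.zero_mem _
    | add r r' hr hr' =>
      have : σ (r + r') - (r + r') = (σ r - r) + (σ r' - r') := by rw [map_add]; ring
      rw [this]; exact Ideal.add_mem _ hr hr'
    | mul_X r i hr =>
      have : σ (r * X i) - r * X i = (σ r - r) * σ (X i) + r * (σ (X i) - X i) := by
        rw [map_mul]; ring
      rw [this]
      exact Ideal.add_mem _ (Ideal.mul_mem_right _ _ hr) (Ideal.mul_mem_left _ _ (hσX i))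
  have hσinvf : ∀ r : MvPolynomial (Fin n) k, σ⁻¹ r - r ∈
      Ideal.span ({X a, X b, X d} : Set (MvPolynomial (Fin n) k)) := by
    intro r
    have h := hσf (σ⁻¹ r)
    have e' : σ (σ⁻¹ r) = r := by rw [← AlgEquiv.mul_apply, mul_inv_cancel, AlgEquiv.one_apply]
    rw [e'] at h
    have : σ⁻¹ r - r = -(r - σ⁻¹ r) := by ring
    rw [this]
    exact neg_mem h
  have hzpow : ∀ (z : ℤ) (r : MvPolynomial (Fin n) k), (σ ^ z) r - r ∈
      Ideal.span ({X a, X b, X d} : Set (MvPolynomial (Fin n) k)) := by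
    intro z
    induction z using Int.induction_on with
    | zero => intro r; rw [zpow_zero, AlgEquiv.one_apply, sub_self]; exact Ideal.zero_mem _
    | succ m ih =>
      intro r
      rw [zpow_add_one, AlgEquiv.mul_apply]
      have e' : (σ ^ (m : ℤ)) (σ r) - r = ((σ ^ (m : ℤ)) (σ r) - σ r) + (σ r - r) := by ring
      rw [e']
      exact Ideal.add_mem _ (ih (σ r)) (hσf r)
    | pred m ih =>
      intro r
      rw [zpow_sub_one, AlgEquiv.mul_apply]
      have e' : (σ ^ (-(m : ℤ))) (σ⁻¹ r) - r =
          ((σ ^ (-(m : ℤ))) (σ⁻¹ r) - σ⁻¹ r) + (σ⁻¹ r - r) := by ring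
      rw [e']
      exact Ideal.add_mem _ (ih (σ⁻¹ r)) (hσinvf r)
  change (g : MvPolynomial (Fin n) k ≃ₐ[k] MvPolynomial (Fin n) k) r - r ∈ _
  rw [← hz]
  exact hzpow z r

include hab hac hae hbd hcd hde hb hc he hσ in
/-- **The `J₃ ⊕ J₂` augmentation ideal is `(x_a, x_b, x_d)`, every `p ≥ 3`**: for `1 ≠ g ∈ ⟨σ⟩`,
`⟨g • f - f : f ∈ k[x]⟩ = (x_a, x_b, x_d)` (`x_a` and `x_d` by the transvections `x_b ↦ x_b + x_a`,
`x_e ↦ x_e + x_d`; `x_b` from `g • x_c − x_c = m x_b + C(m,2) x_a`, `m ∈ kˣ`). [folklore] -/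
theorem span_smul_sub_eq_centre_prime (p : ℕ) (hp : p.Prime) (hp3 : 3 ≤ p) [CharP k p]
    (g : Subgroup.zpowers σ) (hg : g ≠ 1) :
    Ideal.span (Set.range fun f : MvPolynomial (Fin n) k => g • f - f) =
      Ideal.span ({X a, X b, X d} : Set (MvPolynomial (Fin n) k)) := by
  classical
  have hσp : σ ^ p = 1 := pow_prime_eq_one k n σ a b c d e hab hac hae hbd hcd hde hb hc he hσ p hp hp3
  have hXa : (X a : MvPolynomial (Fin n) k) ∈
      Ideal.span (Set.range fun f : MvPolynomial (Fin n) k => g • f - f) :=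
    LinearSmallBlocks.X_mem_augIdeal_of_transvection k p hp σ a b (hσ a hab hac hae) hb hσp g hg
  have hXd : (X d : MvPolynomial (Fin n) k) ∈
      Ideal.span (Set.range fun f : MvPolynomial (Fin n) k => g • f - f) :=
    LinearSmallBlocks.X_mem_augIdeal_of_transvection k p hp σ d e
      (hσ d (Ne.symm hbd) (Ne.symm hcd) hde) he hσp g hg
  obtain ⟨m, hmk, hm'⟩ := JordanFive.exists_natCast_ne_zero_and_pow_eq k n σ p hp hσp g hg
  have hXb : (X b : MvPolynomial (Fin n) k) ∈
      Ideal.span (Set.range fun f : MvPolynomial (Fin n) k => g • f - f) := by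
    have hsmul : g • (X c : MvPolynomial (Fin n) k) - X c =
        (m : MvPolynomial (Fin n) k) * X b + ((m.choose 2 : ℕ) : MvPolynomial (Fin n) k) * X a := by
      change (g : MvPolynomial (Fin n) k ≃ₐ[k] MvPolynomial (Fin n) k) (X c) - X c = _
      rw [← hm', (pow_apply_X_bce k n σ a b c d e hab hac hae hbd hcd hde hb hc he hσ m).2.1]
      ring
    have hmXb : (m : MvPolynomial (Fin n) k) * X b ∈
        Ideal.span (Set.range fun f : MvPolynomial (Fin n) k => g • f - f) := by
      have e' : (m : MvPolynomial (Fin n) k) * X b =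
          (g • (X c : MvPolynomial (Fin n) k) - X c) -
            ((m.choose 2 : ℕ) : MvPolynomial (Fin n) k) * X a := by
        rw [hsmul]; ring
      rw [e']
      exact Ideal.sub_mem _ (Ideal.subset_span ⟨X c, rfl⟩) (Ideal.mul_mem_left _ _ hXa)
    have hx : (X b : MvPolynomial (Fin n) k) = C ((m : k)⁻¹) * ((m : MvPolynomial (Fin n) k) * X b) := by
      rw [← mul_assoc, ← map_natCast (C : k →+* MvPolynomial (Fin n) k) m, ← map_mul,
        inv_mul_cancel₀ hmk, map_one, one_mul]
    rw [hx]
    exact Ideal.mul_mem_left _ _ hmXb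
  apply le_antisymm
  · refine Ideal.span_le.mpr ?_
    rintro _ ⟨f, rfl⟩
    exact smul_sub_mem_centre k n σ a b c d e hb hc he hσ g f
  · refine Ideal.span_le.mpr ?_
    intro x hx
    rcases hx with rfl | rfl | hx
    · exact hXa
    · exact hXb
    · rw [Set.mem_singleton_iff] at hx
      subst hx
      exact hXd

end Summit.ResolutionOfSingularities.ResolutionOfSingularities.Theorems.WildQuotientResolution.JordanThreeTwo

end
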